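import Mathlib

/-!
# SoloBlind — the inner Volterra sums in Abel form ([O1] Lemma A, algebraic part; PLAN §119.12)

With the LG ansatz written as `P k = a k * Λ k`, `Λ (k+1) = λ k * Λ k` (amplitude `a`, accumulated multiplier `Λ`),
the inner sums of `SoloBlindVolterraRepr.volterra_repr` become

  `P (j+1)^2 / (P i * P (i+1)) = A i * G i`,  `A i = a (j+1)^2 / (a i * a (i+1) * λ i)`,  `G i = (∏_{l ∈ [i, j+1)} λ l)^2`,

(`term_rewrite`), and `A i * G i = C i * (G i - G (i+1))` with `C i = A i * λ i ^ 2 / (λ i ^ 2 - 1)` (`abel_form`),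
which is the shape bounded by `SoloBlindAbelBound.abel_bound`.  Pure algebra over `ℂ`.
-/

namespace Summit.AnomalousDissipation.SoloBlind.InnerSum

open Finset

/-- Accumulated multiplier as a product. -/
theorem prod_ratio (Λ lam : ℕ → ℂ) (hΛ : ∀ k, Λ (k + 1) = lam k * Λ k) (i : ℕ) :
    ∀ m, Λ (i + m) = (∏ l ∈ range m, lam (i + l)) * Λ i := by
  intro m
  induction m with
  | zero => simp
  | succ m ih =>
    rw [prod_range_succ, show i + (m + 1) = i + m + 1 from by omega, hΛ (i + m), ih]
    ring

/-- The same over an `Ico` block: `Λ n = (∏_{l ∈ [i, n)} λ l) * Λ i` for `i ≤ n`. -/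
theorem prod_ratio_Ico (Λ lam : ℕ → ℂ) (hΛ : ∀ k, Λ (k + 1) = lam k * Λ k) (i n : ℕ) (hin : i ≤ n) :
    Λ n = (∏ l ∈ Ico i n, lam l) * Λ i := by
  have h := prod_ratio Λ lam hΛ i (n - i)
  rw [show i + (n - i) = n from by omega] at h
  rw [h, prod_Ico_eq_prod_range]

/-- The inner-sum term in product form. -/
theorem term_rewrite (a Λ lam : ℕ → ℂ) (hΛ : ∀ k, Λ (k + 1) = lam k * Λ k)
    (ha : ∀ k, a k ≠ 0) (hΛ0 : ∀ k, Λ k ≠ 0) (hlam : ∀ k, lam k ≠ 0) (i j : ℕ) (hij : i ≤ j) :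
    (a (j + 1) * Λ (j + 1)) ^ 2 / ((a i * Λ i) * (a (i + 1) * Λ (i + 1)))
      = (a (j + 1) ^ 2 / (a i * a (i + 1) * lam i)) * (∏ l ∈ Ico i (j + 1), lam l) ^ 2 := by
  have h1 := prod_ratio_Ico Λ lam hΛ i (j + 1) (by omega)
  have h2 : Λ (i + 1) = lam i * Λ i := hΛ i
  rw [h1, h2]
  have : Λ i ≠ 0 := hΛ0 i
  have : a i ≠ 0 := ha i
  have : a (i + 1) ≠ 0 := ha (i + 1)
  have : lam i ≠ 0 := hlam i
  field_simp

/-- Abel form of one term: `A i * G i = C i * (G i - G (i+1))` with `G i = (∏_{l ∈ [i, n)} λ l)^2`, `i < n`. -/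
theorem abel_form (A lam : ℕ → ℂ) (n i : ℕ) (hin : i < n) (hlam1 : lam i ^ 2 ≠ 1) :
    A i * (∏ l ∈ Ico i n, lam l) ^ 2
      = (A i * lam i ^ 2 / (lam i ^ 2 - 1)) *
          ((∏ l ∈ Ico i n, lam l) ^ 2 - (∏ l ∈ Ico (i + 1) n, lam l) ^ 2) := by
  rw [prod_eq_prod_Ico_succ_bot hin]
  have h1 : lam i ^ 2 - 1 ≠ 0 := sub_ne_zero.mpr hlam1
  field_simp

/-- Uniform modulus bound of the block products for a recessive multiplier beyond an initial stretch:
if `‖lam l‖ ≤ 1` for `l ≥ i₀` then `‖∏_{l ∈ [i, n)} lam l‖ ≤ ∏_{l ∈ [i, i₀)} ‖lam l‖` (empty product `= 1` once `i ≥ i₀`). -/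
theorem block_prod_bound (lam : ℕ → ℂ) (i₀ : ℕ) (hrec : ∀ l, i₀ ≤ l → ‖lam l‖ ≤ 1) (i n : ℕ) (hin : i ≤ n) :
    ‖∏ l ∈ Ico i n, lam l‖ ≤ ∏ l ∈ Ico i (max i (min i₀ n)), ‖lam l‖ := by
  rw [norm_prod]
  set m := max i (min i₀ n) with hm
  have him : i ≤ m := le_max_left _ _
  have hmn : m ≤ n := by rcases le_total i₀ n with h | h <;> simp [hm] <;> omega
  rw [← prod_Ico_consecutive _ him hmn]
  have htail : ∏ l ∈ Ico m n, ‖lam l‖ ≤ 1 := by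
    refine prod_le_one (fun l _ => norm_nonneg _) (fun l hl => ?_)
    rw [mem_Ico] at hl
    exact hrec l (by simp [hm] at hl; omega)
  have hhead : 0 ≤ ∏ l ∈ Ico i m, ‖lam l‖ := prod_nonneg (fun l _ => norm_nonneg _)
  calc (∏ l ∈ Ico i m, ‖lam l‖) * ∏ l ∈ Ico m n, ‖lam l‖
      ≤ (∏ l ∈ Ico i m, ‖lam l‖) * 1 := mul_le_mul_of_nonneg_left htail hhead
    _ = ∏ l ∈ Ico i m, ‖lam l‖ := mul_one _

end Summit.AnomalousDissipation.SoloBlind.InnerSum
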